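import Literature.NumberTheory.LFunctions.CertifiedLFunctionCriticalLineBound
import Literature.Analysis.SpecialFunctions.DigammaBinetLehman
import HarnessLib

/-!
# Platt's Algorithm 2: the time-domain aliasing sum `Σ_{k ∈ ℤ} F(m/A + kB, χ)`
# (Math. Comp. 85 (2016) §7.2, Lemma 7.6, via Booker 2006 Lemma 5.7)

Topic `Literature/NumberTheory/LFunctions`; namespace `Literature.NumberTheory.LFunctions`, engine
sub-namespace `TimeAliasing`. Everything in this file is PROVED (no named fact, no new definition).
Typed for the parity-realchar cell (D-0088 (4) literature-typing layer, row «Platt 2016 (Math. Comp.,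
certified GRH/`L`-function computations)»): instrument provenance for "Algorithm 2" of Platt's GRH
verification `Literature.NumberTheory.LFunctions.platt2016_theorem71/72`
(`DirichletLRiemannHypothesisUpTo.lean`). Step (4) of the algorithm (p. 3017) uses the DFT output
`F̃_e(m, χ) := Σ_{k ∈ ℤ} F_e(m/A + kB, χ)` as an approximation to `F_e(m/A, χ)`; **Lemma 7.6** bounds the
error. Platt: "We apply Lemma 5.7 (i) of [3] with `t = m/A + B` and 5.7 (ii) with `t = m/A − B`,
replacing the bound for `L_χ(s)` with our Lemma 7.3" ([3] = Booker, Experiment. Math. 15 (2006)).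
This file proves that argument for Dirichlet `L`-functions: Booker's Lemma 5.7 (i)/(ii) mechanism
(`TimeAliasing.tail_right`, `TimeAliasing.tail_left`) with Platt's majorant from Lemma 7.3
(`platt2016_lemma73`, the tree's theorem from Rademacher 1959), and Lemma 7.6 for `F_e` and `F_o`
(`platt2016_lemma76_even`, `platt2016_lemma76_odd`, and both at once `platt2016_lemma76`).

Sources (page-confirmed): D. J. Platt, *Numerical computations concerning the GRH*, Math. Comp. **85**
(2016) 3009–3027 [Platt2016GRH], §7.2 Lemma 7.6 p. 3020 = arXiv:1305.3087v1 Lemma 5.6 pp. 10–11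
(statement read from the arXiv LaTeX source, `platt-grh.tex` ll. 642–676; the journal renumbers §5 → §7);
A. R. Booker, *Artin's conjecture, Turing's method, and the Riemann hypothesis*, Experiment. Math. **15**
(2006) 385–407 [Booker2006], Lemma 5.7 with proof = arXiv:math/0507502v1 §5.3 "Asymptotics", last lemma
(`turing.tex` ll. 1937–2001), and (4.3) (Lehman's `Γ'/Γ` estimate, the tree's
`DigammaLehman.lehman1970_lemma8`).

## What is typed, and the correction (recorded — no silent weakening)

Printed (journal Lemma 7.6): "Given `t ∈ ℝ` and `B > 0`, we define
`E_e(t) := ζ(9/8) π^{-1/4} |Γ(1/4 + it/2)| e^{(π/4)ηt} ((q/2π)|3/2 + t|)^{5/16}`,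
`β_e(t) := π/4 − ½ arctan(1/(2|t|)) − 4/(π²|t² − 1/4|)`,
`E_o(t) := ζ(9/8) π^{-3/4} |Γ(3/4 + it/2)| e^{(π/4)ηt} ((q/2π)|3/2 + t|)^{5/16}` and
`β_o(t) := π/4 − (3/2) arctan(1/(2|t|)) − 4/(π²|t² − 9/4|)`. Then for `β_{e,o}(m/A + B) > (π/4)η` and
`β_{e,o}(m/A − B) > −(π/4)η` we have
`|F̃_e(m, χ) − F_e(m/A, χ)| ≤ E_e(m/A+B)/(1 − exp(−B(β_e(m/A+B) − (π/4)η))) + E_e(m/A−B)/(1 − exp(−B(β_e(m/A−B) + (π/4)η)))`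
and [the same with `o`]."

* `E`: Lemma 7.3 (`|L_χ(1/2+it)| ≤ ζ(9/8)(q/2π)^{5/16}(3/2 + |t|)^{5/16}`) — the bound the printed proof
  substitutes into Booker's `E` — carries `(3/2 + |t|)^{5/16}`, while the printed `E_{e,o}` carries
  `|3/2 + t|^{5/16}`. The two agree at `t = m/A + B > 0` and differ at `t = m/A − B < 0`, where
  `3/2 + |t| > |3/2 + t|` (and the printed `E(−3/2) = 0`). The theorems here carry `(3/2 + |t|)^{5/16}`:
  the first term is the printed one, the second is what the printed proof delivers (larger than
  printed). Whether the printed second term also holds is not decided here.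
* `m`: `F̃(m, χ)` is indexed by the DFT samples `m = 0, …, N − 1`, `N = AB` (p. 3017, "`A, B > 0` with
  `AB ∈ 2^ℕ`"); the hypotheses `0 ≤ m < AB` make `m/A + B > 0 > m/A − B`, the sign conditions
  "`Im(s + μ_j) > 0`" / "`< 0`" of Booker's (i)/(ii) (Platt's remark after the lemma: the `β` condition
  "will fail when `t` is small, i.e. when `m/A ≈ B` … for `m` approaching `AB`"). `AB ∈ 2^ℕ` is not needed.
* `β`: verbatim (Platt's `(3/2)arctan(1/(2|t|))` for `F_o` is weaker than Booker's `½arctan(3/(2|t|))`: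
  `arctan 3u ≤ 3 arctan u`). At `|t| = c` (`c = 1/2`, `3/2`) the printed `β` has a zero denominator;
  Lean's `4/0 = 0` value is covered by the proofs, so no definedness hypothesis is added.
* Not used (hence not assumed): the parity of `χ`, `|η| < 1`, realness of `F`; `ε_χ` enters only through
  `‖ε_χ‖ = 1`.
* A gap in the printed proof of Booker's Lemma 5.7, closed here: the step "`≤ −βkB`" uses that
  `4/(π²|Im(s*+μ)² − Re(s*+μ)²|)` decreases along the segment, true only when `|Im(s+μ)| > Re(s+μ)`, i.e.
  `|t| > c`; the hypotheses allow `|t| < c` (odd case, e.g. `t = 1`, `η > 0.3`). There the conclusion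
  still holds because `β(t) < 0` while `Im ψ > 0` (`TimeAliasing.rate`, cases `t < c`).

## Method (Booker's proof, r = 1, with Platt's majorant)

`|F(τ, χ)| ≤ E(τ) = K ‖Γ((c+i|τ|)/2)‖ (3/2+|τ|)^{5/16} e^{πητ/4}`, `K = ζ(9/8)π^{-c/2}(q/2π)^{5/16}`
(`TimeAliasing.norm_F_le`). Booker: "by the mean value theorem
`log(|γ(s+ikB)/γ(s)| |Q(s+ikB)/Q(s)|^{1/2}) = −kB Im(γ'/γ + ½Q'/Q)(s*)` … Using (4.3), this is
`≤ −kB(π r/4 − ½Σ arctan(Re(s*+μ_j)/Im(s*+μ_j)) − (4/π²)Σ 1/|Im(s*+μ_j)² − Re(s*+μ_j)²|) ≤ −βkB`. Thus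
`|F(t+kB)| ≤ E e^{−(β − πrη/4)kB}`. The conclusion follows." Here: `φ(u) = log‖Γ((c+iu)/2)‖ +
(5/16)log(3/2+u) + β(t)u` is antitone on `[t, ∞)` (`TimeAliasing.decay`), because
`φ'(u) = −½ Im ψ((c+iu)/2) + (5/16)/(3/2+u) + β(t) ≤ 0` (`TimeAliasing.rate`): for `u > c` by Lehman's
(4.3) in the form `Im ψ(x+iy) ≥ π/2 − arctan(x/y) + y/(2(x²+y²)) − 2/(π²(y²−x²))`
(`TimeAliasing.lehman_le_im_digamma`; the `+y/(2|z|²)` from `−1/(2z)` absorbs the growth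
`(5/16)/(3/2+u)` of Lemma 7.3's bound exactly as it absorbs Booker's `½Q'/Q`), monotonicity of Booker's
rate in `u`, and `arctan 3u ≤ 3arctan u`; for `u ≤ c` by `Im ψ(w) = Σ_k Im w/|w+k|² ≥ 0` and its first
terms (`TimeAliasing.sum_le_im_digamma`, from the tree's series `hasSum_one_div_sub_one_div_digamma`)
against explicit negative upper bounds for Platt's `β` on `(0, c)` (three `arctan v ≥ v/(1+v²)` cells),
and at the junk points `t = c` by four series terms on `[c, 2c]` plus Lehman beyond. Then the geometric
series (`tail_right`; `tail_left` is the reflection `u ↦ −u`, `η ↦ −η`, `|Γ(conj z)| = |Γ(z)|`), and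
`Σ_{k ∈ ℤ} = (k = 0) + Σ_{k ≥ 1} + Σ_{k ≤ −1}` (Mathlib's `tsum_of_nat_of_neg_add_one`).

`lean search` / tree inventory (2026-08-27): Lemma 7.6 and Booker's Lemma 5.7 were not in the tree
(`CertifiedLFunctionCriticalLineBound.lean`, `CertifiedLFunctionFourierTail.lean` list them as "NOT here");
used from the tree: `platt2016_lemma73`, `DigammaLehman.abs_im_digamma_sub_arg_add_le_lehman`,
`DigammaLehman.div_one_add_sq_le_arctan`, `Complex.hasSum_one_div_sub_one_div_digamma`,
`Booker2006Turing.bigZ`; from Mathlib: `Complex.digamma`, `Complex.differentiableAt_Gamma`,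
`HasDerivAt.norm_sq`, `antitoneOn_of_hasDerivWithinAt_nonpos`, `Complex.tan_arg`, `Real.arctan_inv_of_pos`,
`hasSum_geometric_of_lt_one`. Nothing is restated.

## References

* [Platt2016GRH] D. J. Platt, *Numerical computations concerning the GRH*, Math. Comp. 85 (2016),
  no. 302, 3009–3027, doi:10.1090/mcom/3077: §7.2 Lemma 7.6 p. 3020 (arXiv:1305.3087v1 Lemma 5.6,
  pp. 10–11), Lemma 7.3 p. 3019, `F_e`, `F_o`, `F̃` p. 3017.
* [Booker2006] A. R. Booker, *Artin's conjecture, Turing's method, and the Riemann hypothesis*,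
  Experiment. Math. 15 (2006) 385–407: Lemma 5.7 and its proof (§5.3), (4.3) (arXiv:math/0507502v1).
* [Lehman1970] R. S. Lehman, *On the distribution of zeros of the Riemann zeta-function*, Proc. LMS (3)
  20 (1970) 303–320, Lemma 8 p. 308 (Booker's (4.3)).
-/

noncomputable section

open Complex Filter Topology Set
open scoped Real

namespace Literature.NumberTheory.LFunctions

namespace TimeAliasing

/-! ## §1 Elementary inequalities for `arctan` -/

/-- `arctan v ≤ v` for `v ≥ 0`. [folklore] -/
private theorem arctan_le_self {v : ℝ} (hv : 0 ≤ v) : Real.arctan v ≤ v := by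
  rcases hv.eq_or_lt with h | h
  · rw [← h, Real.arctan_zero]
  · have h1 : 0 < Real.arctan v := by
      rw [← Real.arctan_zero]; exact Real.arctan_strictMono h
    have h2 : Real.arctan v < π / 2 := Real.arctan_lt_pi_div_two v
    have := Real.le_tan h1.le h2
    rwa [Real.tan_arctan] at this

/-- `arctan (3u) ≤ 3 arctan u` for `u ≥ 0` (the derivative of `3 arctan u − arctan 3u` is
`3/(1+u²) − 3/(1+9u²) ≥ 0`). [folklore] -/
private theorem arctan_three_mul_le {u : ℝ} (hu : 0 ≤ u) : Real.arctan (3 * u) ≤ 3 * Real.arctan u := by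
  let g : ℝ → ℝ := fun u => 3 * Real.arctan u - Real.arctan (3 * u)
  let g' : ℝ → ℝ := fun x => 3 * (1 / (1 + x ^ 2)) - 1 / (1 + (3 * x) ^ 2) * 3
  have hg : ∀ x, HasDerivAt g (g' x) x := by
    intro x
    have h1 := (Real.hasDerivAt_arctan x).const_mul 3
    have h2 := (Real.hasDerivAt_arctan (3 * x)).comp x ((hasDerivAt_id x).const_mul 3)
    simp only [mul_one] at h2
    exact h1.sub h2
  have hmono : MonotoneOn g (Ici 0) := by
    refine monotoneOn_of_hasDerivWithinAt_nonneg (convex_Ici 0) (f' := g')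
      (fun x _ => (hg x).continuousAt.continuousWithinAt)
      (fun x _ => (hg x).hasDerivWithinAt) ?_
    intro x _
    have h0 : 0 < 1 + x ^ 2 := by positivity
    have hle : 1 + x ^ 2 ≤ 1 + (3 * x) ^ 2 := by nlinarith [sq_nonneg x]
    have h := one_div_le_one_div_of_le h0 hle
    show 0 ≤ 3 * (1 / (1 + x ^ 2)) - 1 / (1 + (3 * x) ^ 2) * 3
    nlinarith
  have h := hmono (self_mem_Ici (a := (0 : ℝ))) (show u ∈ Ici (0 : ℝ) from hu) hu
  simp only [g, Real.arctan_zero, mul_zero, sub_zero] at h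
  linarith

/-! ## §2 Digamma: the series for `Im ψ` and Lehman's lower bound -/

/-- Imaginary part of `ψ(w) + γ = Σ_{k ≥ 0} (1/(k+1) − 1/(w+k))` (Andrews–Askey–Roy (1.2.13), the
tree's `hasSum_one_div_sub_one_div_digamma`): for `Re w > 0`,
`Im ψ(w) = Σ_{k ≥ 0} Im w / ((Re w + k)² + (Im w)²)`. [cite: AndrewsAskeyRoy1999, Thm 1.2.5 (1.2.13)] -/
theorem hasSum_im_digamma {w : ℂ} (hw : 0 < w.re) :
    HasSum (fun k : ℕ => w.im / ((w.re + k) ^ 2 + w.im ^ 2)) (Complex.digamma w).im := by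
  have h := Complex.hasSum_im
    (Literature.Analysis.SpecialFunctions.Complex.hasSum_one_div_sub_one_div_digamma hw)
  simp only [Complex.add_im, Complex.ofReal_im, add_zero] at h
  refine h.congr_fun fun k => ?_
  have hk : (1 / ((k : ℂ) + 1)).im = 0 := by
    rw [show ((k : ℂ) + 1) = ((k + 1 : ℝ) : ℂ) by push_cast; ring, ← Complex.ofReal_one,
      ← Complex.ofReal_div, Complex.ofReal_im]
  have hne : (w.re + k) ^ 2 + w.im ^ 2 ≠ 0 := by positivity
  rw [Complex.sub_im, hk, zero_sub, one_div, Complex.inv_im, Complex.normSq_apply]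
  simp only [Complex.add_re, Complex.natCast_re, Complex.add_im, Complex.natCast_im, add_zero]
  rw [neg_div, neg_neg]
  congr 1
  ring

/-- Partial sums bound `Im ψ` from below in the upper half of the right half-plane:
`Σ_{k<N} Im w/((Re w + k)² + (Im w)²) ≤ Im ψ(w)` for `Re w > 0`, `Im w ≥ 0` (positivity of the terms of
Andrews–Askey–Roy (1.2.13)). [cite: AndrewsAskeyRoy1999, Thm 1.2.5 (1.2.13)] -/
theorem sum_le_im_digamma {w : ℂ} (hw : 0 < w.re) (hwi : 0 ≤ w.im) (N : ℕ) :
    ∑ k ∈ Finset.range N, w.im / ((w.re + k) ^ 2 + w.im ^ 2) ≤ (Complex.digamma w).im :=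
  sum_le_hasSum _ (fun k _ => by positivity) (hasSum_im_digamma hw)

/-- `Im ψ(w) ≥ 0` for `Re w > 0`, `Im w ≥ 0` (all terms of Andrews–Askey–Roy (1.2.13) have
nonnegative imaginary part). [cite: AndrewsAskeyRoy1999, Thm 1.2.5 (1.2.13)] -/
theorem im_digamma_nonneg {w : ℂ} (hw : 0 < w.re) (hwi : 0 ≤ w.im) :
    0 ≤ (Complex.digamma w).im := by
  simpa using sum_le_im_digamma hw hwi 0

/-- The argument of `x + iy`, `x > 0`: `arg (x + iy) = arctan (y/x)`. [folklore] -/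
private theorem arg_eq_arctan {x y : ℝ} (hx : 0 < x) :
    Complex.arg (x + y * I) = Real.arctan (y / x) := by
  have hre : (x + y * I : ℂ).re = x := by simp
  have him : (x + y * I : ℂ).im = y := by simp
  have ht : Real.tan (Complex.arg (x + y * I)) = y / x := by rw [Complex.tan_arg, him, hre]
  have hlt : |Complex.arg (x + y * I)| < π / 2 :=
    Complex.abs_arg_lt_pi_div_two_iff.mpr (Or.inl (by rw [hre]; exact hx))
  rw [abs_lt] at hlt
  rw [← ht, Real.arctan_tan hlt.1 hlt.2]

/-- **Lehman's lower bound for `Im ψ` on a vertical line** (from the tree's Lehman 1970 Lemma 8,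
`DigammaLehman.abs_im_digamma_sub_arg_add_le_lehman`): for `0 < x < y`,
`Im ψ(x + iy) ≥ π/2 − arctan(x/y) + y/(2(x² + y²)) − 2/(π²(y² − x²))`.
[cite: Lehman1970, Lemma 8, p. 308] [cite: Booker2006, §4 (4.3) and proof of Lemma 5.7] -/
theorem lehman_le_im_digamma {x y : ℝ} (hx : 0 < x) (hxy : x < y) :
    π / 2 - Real.arctan (x / y) + y / (2 * (x ^ 2 + y ^ 2)) - 2 / (π ^ 2 * (y ^ 2 - x ^ 2)) ≤
      (Complex.digamma (x + y * I)).im := by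
  have hy : 0 < y := hx.trans hxy
  have hzre : (x + y * I : ℂ).re = x := by simp
  have hzim : (x + y * I : ℂ).im = y := by simp
  have hz : 0 < (x + y * I : ℂ).re := by rw [hzre]; exact hx
  have hyx : 0 < y ^ 2 - x ^ 2 := by nlinarith
  have hd : (x + y * I : ℂ).im ^ 2 ≠ (x + y * I : ℂ).re ^ 2 := by
    rw [hzre, hzim]; exact fun h => by linarith
  have h := Literature.Analysis.SpecialFunctions.DigammaLehman.abs_im_digamma_sub_arg_add_le_lehman
    hz hd
  rw [hzre, hzim, abs_of_pos hyx] at h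
  have harg : Complex.arg (x + y * I) = π / 2 - Real.arctan (x / y) := by
    rw [arg_eq_arctan hx, show y / x = (x / y)⁻¹ by rw [inv_div],
      Real.arctan_inv_of_pos (div_pos hx hy)]
  have hne : (x : ℂ) + y * I ≠ 0 := fun h0 => by
    have := congrArg Complex.re h0; simp at this; linarith
  have him : (1 / (2 * ((x : ℂ) + y * I))).im = -(y / (2 * (x ^ 2 + y ^ 2))) := by
    have h2 : (2 * ((x : ℂ) + y * I)) = ((2 * x : ℝ) : ℂ) + ((2 * y : ℝ) : ℂ) * I := by
      push_cast; ring
    rw [h2, one_div, Complex.inv_im, Complex.normSq_apply]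
    simp
    field_simp
  rw [harg, him] at h
  have := (abs_le.mp h).1
  linarith

/-! ## §3 The derivative of `log ‖Γ((c + iτ)/2)‖` -/

/-- `d/dx log ‖F(x)‖ = Re (F'(x)/F(x))` for a differentiable `F : ℝ → ℂ` with `F(x) ≠ 0`.
[folklore] -/
private theorem hasDerivAt_log_norm {F : ℝ → ℂ} {F' : ℂ} {x : ℝ} (hF : HasDerivAt F F' x)
    (h0 : F x ≠ 0) : HasDerivAt (fun x => Real.log ‖F x‖) ((F' / F x).re) x := by
  have h1 : HasDerivAt (fun x => ‖F x‖ ^ 2) (2 * @inner ℝ ℂ _ (F x) F') x := hF.norm_sq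
  have hn : 0 < ‖F x‖ := norm_pos_iff.mpr h0
  have hn0 : ‖F x‖ ^ 2 ≠ 0 := by positivity
  have h2 := (h1.log hn0).const_mul (1 / 2 : ℝ)
  have heq : (fun x => (1 / 2 : ℝ) * Real.log (‖F x‖ ^ 2)) = fun x => Real.log ‖F x‖ := by
    funext y; rw [Real.log_pow]; push_cast; ring
  rw [heq] at h2
  refine h2.congr_deriv ?_
  rw [Complex.inner, Complex.div_re, Complex.normSq_eq_norm_sq]
  simp only [Complex.mul_re, Complex.conj_re, Complex.conj_im]
  field_simp
  ring

/-- For `c > 0`: `d/dτ log ‖Γ((c + iτ)/2)‖ = −½ Im ψ((c + iτ)/2)` (chain rule with `Γ' = Γψ`) — the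
derivative behind Booker's mean-value step "`log|γ(s+ikB)/γ(s)| = −kB Im γ'/γ(s*)`".
[cite: Booker2006, proof of Lemma 5.7] -/
theorem hasDerivAt_log_norm_Gamma {c : ℝ} (hc : 0 < c) (τ : ℝ) :
    HasDerivAt (fun τ : ℝ => Real.log ‖Complex.Gamma ((c + τ * I) / 2)‖)
      (-(1 / 2) * (Complex.digamma ((c + τ * I) / 2)).im) τ := by
  set z : ℂ := ((c : ℂ) + τ * I) / 2 with hz
  have hzre : z.re = c / 2 := by simp [hz]
  have hzpos : 0 < z.re := by rw [hzre]; positivity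
  have hzne : ∀ m : ℕ, z ≠ -m := fun m h => by
    have := congrArg Complex.re h
    rw [hzre] at this; simp at this; linarith
  have hΓ : HasDerivAt Complex.Gamma (deriv Complex.Gamma z) z :=
    (Complex.differentiableAt_Gamma z hzne).hasDerivAt
  have hlin : HasDerivAt (fun τ : ℝ => ((c : ℂ) + τ * I) / 2) (1 * I / 2) τ :=
    (((hasDerivAt_id τ).ofReal_comp.mul_const I).const_add (c : ℂ)).div_const 2
  have hG : HasDerivAt (fun τ : ℝ => Complex.Gamma (((c : ℂ) + τ * I) / 2))
      (deriv Complex.Gamma z * (1 * I / 2)) τ := hΓ.comp τ hlin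
  have hG0 : Complex.Gamma z ≠ 0 := Complex.Gamma_ne_zero_of_re_pos hzpos
  have h := hasDerivAt_log_norm hG hG0
  convert h using 1
  rw [Complex.digamma_def, logDeriv_apply]
  rw [show deriv Complex.Gamma z * (1 * I / 2) / Complex.Gamma z =
      deriv Complex.Gamma z / Complex.Gamma z * (I / 2) by ring]
  rw [Complex.mul_re]
  simp
  ring

/-! ## §4 The rate inequality `β(t) ≤ ½ Im ψ((c + iτ)/2) − (5/16)/(3/2 + τ)` for `τ ≥ t` -/

/-- `(c + iτ)/2 = c/2 + i(τ/2)` with real casts. [folklore] -/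
private theorem half_arg (c τ : ℝ) :
    ((c : ℂ) + τ * I) / 2 = ((c / 2 : ℝ) : ℂ) + ((τ / 2 : ℝ) : ℂ) * I := by
  push_cast; ring

/-- Booker's step (proof of Lemma 5.7): on `τ > c` Lehman's estimate gives
`π/4 − ½ arctan(c/τ) − 4/(π²(τ² − c²)) ≤ ½ Im ψ((c+iτ)/2) − (5/16)/(3/2 + τ)`; the growth
`(5/16)/(3/2+τ)` of Platt's Lemma 7.3 bound is absorbed by the `−1/(2z)` term of Stirling's formula
(`τ/(2(c²+τ²)) ≥ (5/16)/(3/2+τ)` for `τ ≥ c`, `0 < c ≤ 3/2`). [cite: Booker2006, proof of Lemma 5.7] -/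
theorem lehman_route {c τ : ℝ} (hc : 0 < c) (hc' : c ≤ 3 / 2) (hcτ : c < τ) :
    π / 4 - 1 / 2 * Real.arctan (c / τ) - 4 / (π ^ 2 * (τ ^ 2 - c ^ 2)) ≤
      1 / 2 * (Complex.digamma (((c : ℂ) + τ * I) / 2)).im - 5 / 16 / (3 / 2 + τ) := by
  have hτ : 0 < τ := hc.trans hcτ
  have h := lehman_le_im_digamma (x := c / 2) (y := τ / 2) (by positivity) (by linarith)
  rw [← half_arg] at h
  have e1 : c / 2 / (τ / 2) = c / τ := by field_simp
  have e2 : τ / 2 / (2 * ((c / 2) ^ 2 + (τ / 2) ^ 2)) = τ / (c ^ 2 + τ ^ 2) := by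
    rw [div_div]; congr 1; ring
  have e3 : 2 / (π ^ 2 * ((τ / 2) ^ 2 - (c / 2) ^ 2)) = 8 / (π ^ 2 * (τ ^ 2 - c ^ 2)) := by
    field_simp; ring
  rw [e1, e2, e3] at h
  have hb : 5 / 16 / (3 / 2 + τ) ≤ τ / (2 * (c ^ 2 + τ ^ 2)) := by
    rw [div_le_div_iff₀ (by positivity) (by positivity)]
    nlinarith [mul_nonneg (sub_nonneg.2 hcτ.le) hτ.le, mul_pos hc hτ]
  have e4 : τ / (2 * (c ^ 2 + τ ^ 2)) = 1 / 2 * (τ / (c ^ 2 + τ ^ 2)) := by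
    field_simp
  have e5 : 4 / (π ^ 2 * (τ ^ 2 - c ^ 2)) = 1 / 2 * (8 / (π ^ 2 * (τ ^ 2 - c ^ 2))) := by ring
  rw [e4] at hb
  rw [e5]
  linarith

/-- Monotonicity of Booker's rate `π/4 − ½arctan(c/t) − 4/(π²(t² − c²))` on `(c, ∞)` — the step
"`≤ −βkB`" of Booker's proof (the rate at `s*` is at least the rate at `s`). [cite: Booker2006, proof of Lemma 5.7] -/
theorem booker_rate_mono {c t τ : ℝ} (hc : 0 < c) (hct : c < t) (htτ : t ≤ τ) :
    π / 4 - 1 / 2 * Real.arctan (c / t) - 4 / (π ^ 2 * (t ^ 2 - c ^ 2)) ≤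
      π / 4 - 1 / 2 * Real.arctan (c / τ) - 4 / (π ^ 2 * (τ ^ 2 - c ^ 2)) := by
  have ht : 0 < t := hc.trans hct
  have h1 : Real.arctan (c / τ) ≤ Real.arctan (c / t) :=
    Real.arctan_strictMono.monotone (div_le_div_of_nonneg_left hc.le ht htτ)
  have h2 : 0 < t ^ 2 - c ^ 2 := by nlinarith
  have h3 : 4 / (π ^ 2 * (τ ^ 2 - c ^ 2)) ≤ 4 / (π ^ 2 * (t ^ 2 - c ^ 2)) := by
    apply div_le_div_of_nonneg_left (by norm_num) (by positivity)
    apply mul_le_mul_of_nonneg_left _ (by positivity)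
    nlinarith
  linarith

/-- The crude bound `−5/24 ≤ ½ Im ψ((c+iτ)/2) − (5/16)/(3/2+τ)` (`Im ψ ≥ 0`, `τ > 0`, `c > 0`).
[folklore] -/
private theorem rate_ge_neg {c τ : ℝ} (hc : 0 < c) (hτ : 0 < τ) :
    -(5 / 24 : ℝ) ≤ 1 / 2 * (Complex.digamma (((c : ℂ) + τ * I) / 2)).im - 5 / 16 / (3 / 2 + τ) := by
  have h0 : 0 ≤ (Complex.digamma (((c : ℂ) + τ * I) / 2)).im := by
    rw [half_arg]
    exact im_digamma_nonneg (by simp; positivity) (by simp; positivity)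
  have h1 : 5 / 16 / (3 / 2 + τ) ≤ 5 / 16 / (3 / 2 : ℝ) :=
    div_le_div_of_nonneg_left (by norm_num) (by norm_num) (by linarith)
  linarith

/-- `y ↦ y/(a² + y²)` increases on `[0, a]` … [folklore] -/
private theorem div_sq_add_sq_mono {a y y' : ℝ} (hy : 0 < y) (hyy' : y ≤ y') (ha : y' ≤ a) :
    y / (a ^ 2 + y ^ 2) ≤ y' / (a ^ 2 + y' ^ 2) := by
  have hy' : 0 < y' := hy.trans_le hyy'
  rw [div_le_div_iff₀ (by positivity) (by positivity)]
  nlinarith [mul_nonneg (sub_nonneg.2 hyy') (sub_nonneg.2 (mul_le_mul ha (hyy'.trans ha) hy.le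
    (hy.le.trans (hyy'.trans ha)))), hy]

/-- … and decreases on `[a, ∞)`. [folklore] -/
private theorem div_sq_add_sq_anti {a y y' : ℝ} (ha0 : 0 < a) (ha : a ≤ y) (hyy' : y ≤ y') :
    y' / (a ^ 2 + y' ^ 2) ≤ y / (a ^ 2 + y ^ 2) := by
  have hy : 0 < y := ha0.trans_le ha
  rw [div_le_div_iff₀ (by positivity) (by positivity)]
  nlinarith [mul_nonneg (sub_nonneg.2 hyy') (sub_nonneg.2 (mul_le_mul ha (ha.trans hyy') ha0.le
    hy.le)), hy]

/-- Four terms of the series for `Im ψ(x + iy)` on a cell `y ∈ [y₁, y₂]` with `x ≤ y₁`, `y₂ ≤ x + 1`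
(the `k = 0` term is decreasing in `y` there, the others increasing). [folklore] -/
private theorem im_digamma_ge_cell {x y y₁ y₂ : ℝ} (hx : 0 < x) (h1 : x ≤ y₁) (h2 : y₁ ≤ y) (h3 : y ≤ y₂)
    (h4 : y₂ ≤ x + 1) :
    y₂ / (x ^ 2 + y₂ ^ 2) + y₁ / ((x + 1) ^ 2 + y₁ ^ 2) + y₁ / ((x + 2) ^ 2 + y₁ ^ 2) +
        y₁ / ((x + 3) ^ 2 + y₁ ^ 2) ≤ (Complex.digamma (x + y * I)).im := by
  have hy₁ : 0 < y₁ := hx.trans_le h1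
  have hy : 0 < y := hy₁.trans_le h2
  have hs := sum_le_im_digamma (w := x + y * I) (by simp; exact hx) (by simp; exact hy.le) 4
  simp only [Finset.sum_range_succ, Finset.sum_range_zero, zero_add, Complex.add_re,
    Complex.ofReal_re, Complex.mul_re, Complex.I_re, mul_zero, Complex.ofReal_im, Complex.I_im,
    mul_one, sub_self, add_zero, Complex.add_im, Complex.mul_im, zero_add, Nat.cast_zero,
    Nat.cast_one, Nat.cast_ofNat] at hs
  have t0 : y₂ / (x ^ 2 + y₂ ^ 2) ≤ y / (x ^ 2 + y ^ 2) := div_sq_add_sq_anti hx (h1.trans h2) h3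
  have t1 : y₁ / ((x + 1) ^ 2 + y₁ ^ 2) ≤ y / ((x + 1) ^ 2 + y ^ 2) :=
    div_sq_add_sq_mono hy₁ h2 (by linarith)
  have t2 : y₁ / ((x + 2) ^ 2 + y₁ ^ 2) ≤ y / ((x + 2) ^ 2 + y ^ 2) :=
    div_sq_add_sq_mono hy₁ h2 (by linarith)
  have t3 : y₁ / ((x + 3) ^ 2 + y₁ ^ 2) ≤ y / ((x + 3) ^ 2 + y ^ 2) :=
    div_sq_add_sq_mono hy₁ h2 (by linarith)
  have e0 : x ^ 2 + y ^ 2 = (x + 0) ^ 2 + y ^ 2 := by ring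
  linarith

/-- First term of the series, odd case: for `τ ≥ 2/5`,
`0 ≤ ½ Im ψ((3/2+iτ)/2) − (5/16)/(3/2+τ)` (`½ · Im z/|z|² = 4τ/(9+4τ²) ≥ (5/16)/(3/2+τ)`).
[folklore] -/
private theorem rate_odd_nonneg {τ : ℝ} (hτ : 2 / 5 ≤ τ) :
    0 ≤ 1 / 2 * (Complex.digamma ((((3 / 2 : ℝ) : ℂ) + τ * I) / 2)).im - 5 / 16 / (3 / 2 + τ) := by
  have hτ0 : 0 < τ := by linarith
  have hs := sum_le_im_digamma (w := ((3 / 2 / 2 : ℝ) : ℂ) + ((τ / 2 : ℝ) : ℂ) * I)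
    (by norm_num) (by simp; positivity) 1
  simp only [Finset.sum_range_succ, Finset.sum_range_zero, zero_add, Complex.add_re,
    Complex.ofReal_re, Complex.mul_re, Complex.I_re, mul_zero, Complex.ofReal_im, Complex.I_im,
    mul_one, sub_self, add_zero, Complex.add_im, Complex.mul_im, Nat.cast_zero] at hs
  have e : τ / 2 / ((3 / 2 / 2) ^ 2 + (τ / 2) ^ 2) = 8 * τ / (9 + 4 * τ ^ 2) := by
    rw [div_div, div_eq_div_iff (by positivity) (by positivity)]; ring
  rw [e, ← half_arg] at hs
  have hb : 5 / 16 / (3 / 2 + τ) ≤ 1 / 2 * (8 * τ / (9 + 4 * τ ^ 2)) := by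
    rw [show 1 / 2 * (8 * τ / (9 + 4 * τ ^ 2)) = 4 * τ / (9 + 4 * τ ^ 2) by ring,
      div_le_div_iff₀ (by positivity) (by positivity)]
    nlinarith [mul_nonneg (sub_nonneg.2 hτ) hτ0.le]
  linarith

/-- Platt's `β_e(t) = π/4 − ½arctan(1/(2t)) − 4/(π²(1/4 − t²)) ≤ −5/24` for `0 < t < 1/2`
(`4/(π²(1/4 − t²)) ≥ 16/π² > π/4 + 5/24`). [folklore] -/
private theorem beta_even_small {t : ℝ} (ht : 0 < t) (ht2 : t < 1 / 2) :
    π / 4 - 1 / 2 * Real.arctan (1 / (2 * t)) - 4 / (π ^ 2 * |t ^ 2 - (1 / 2) ^ 2|) ≤ -(5 / 24) := by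
  have hπ := Real.pi_lt_d2
  have hπ0 := Real.pi_pos
  have ha : 0 ≤ Real.arctan (1 / (2 * t)) := by
    rw [← Real.arctan_zero]; exact Real.arctan_strictMono.monotone (by positivity)
  have hd : 0 < (1 / 2) ^ 2 - t ^ 2 := by nlinarith
  rw [abs_of_neg (by linarith), neg_sub]
  have h16 : 16 / π ^ 2 ≤ 4 / (π ^ 2 * ((1 / 2) ^ 2 - t ^ 2)) := by
    rw [div_le_div_iff₀ (by positivity) (by positivity)]
    nlinarith [sq_nonneg t, hπ0]
  have h16' : (8 / 5 : ℝ) ≤ 16 / π ^ 2 := by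
    rw [le_div_iff₀ (by positivity)]; nlinarith
  linarith

/-- Platt's `β_o(t) = π/4 − (3/2)arctan(1/(2t)) − 4/(π²(9/4 − t²)) < 0` for `0 < t < 3/2`
(three cells, `arctan v ≥ v/(1+v²)`). [folklore] -/
private theorem beta_odd_neg {t : ℝ} (ht : 0 < t) (ht2 : t < 3 / 2) :
    π / 4 - 3 / 2 * Real.arctan (1 / (2 * t)) - 4 / (π ^ 2 * |t ^ 2 - (3 / 2) ^ 2|) < 0 := by
  have hπ := Real.pi_lt_d2
  have hπ0 := Real.pi_pos
  have hd : 0 < (3 / 2) ^ 2 - t ^ 2 := by nlinarith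
  rw [abs_of_neg (by linarith), neg_sub]
  have hπ2 : π ^ 2 < 3.15 ^ 2 := by nlinarith
  -- arctan lower bound at the right end of a cell, second term at the left end
  have key : ∀ (a v d : ℝ), 0 ≤ v → v ≤ 1 / (2 * t) → 0 < d → (3 / 2) ^ 2 - t ^ 2 ≤ d →
      π / 4 < 3 / 2 * (v / (1 + v ^ 2)) + 4 / (3.15 ^ 2 * d) →
      a = π / 4 - 3 / 2 * Real.arctan (1 / (2 * t)) - 4 / (π ^ 2 * ((3 / 2) ^ 2 - t ^ 2)) → a < 0 := by
    intro a v d hv hvt hd0 hdt hnum ha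
    have h1 : v / (1 + v ^ 2) ≤ Real.arctan (1 / (2 * t)) :=
      (Literature.Analysis.SpecialFunctions.DigammaLehman.div_one_add_sq_le_arctan hv).trans
        (Real.arctan_strictMono.monotone hvt)
    have h2 : 4 / (3.15 ^ 2 * d) ≤ 4 / (π ^ 2 * ((3 / 2) ^ 2 - t ^ 2)) := by
      apply div_le_div_of_nonneg_left (by norm_num) (by positivity)
      exact mul_le_mul hπ2.le hdt hd.le (by positivity)
    rw [ha]; linarith
  rcases le_or_gt t (9 / 10) with h9 | h9
  · refine key _ (5 / 9) ((3 / 2) ^ 2) (by norm_num) ?_ (by norm_num) (by nlinarith) ?_ rfl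
    · rw [le_div_iff₀ (by positivity)]; nlinarith
    · have : π / 4 < (0.7875 : ℝ) := by linarith
      refine this.trans_le ?_
      norm_num
  rcases le_or_gt t (6 / 5) with h6 | h6
  · refine key _ (5 / 12) ((3 / 2) ^ 2 - (9 / 10) ^ 2) (by norm_num) ?_ (by norm_num)
      (by nlinarith) ?_ rfl
    · rw [le_div_iff₀ (by positivity)]; nlinarith
    · have : π / 4 < (0.7875 : ℝ) := by linarith
      refine this.trans_le ?_
      norm_num
  · refine key _ (1 / 3) ((3 / 2) ^ 2 - (6 / 5) ^ 2) (by norm_num) ?_ (by norm_num)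
      (by nlinarith) ?_ rfl
    · rw [le_div_iff₀ (by positivity)]; nlinarith
    · have : π / 4 < (0.7875 : ℝ) := by linarith
      refine this.trans_le ?_
      norm_num

/-- For `0 < t < 2/5`: `β_o(t) ≤ −5/24` (`arctan(1/(2t)) ≥ arctan(5/4) = π/2 − arctan(4/5) ≥ π/2 − 4/5`).
[folklore] -/
private theorem beta_odd_small {t : ℝ} (ht : 0 < t) (ht2 : t < 2 / 5) :
    π / 4 - 3 / 2 * Real.arctan (1 / (2 * t)) - 4 / (π ^ 2 * |t ^ 2 - (3 / 2) ^ 2|) ≤ -(5 / 24) := by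
  have hπ := Real.pi_gt_d2
  have h1 : Real.arctan (5 / 4) ≤ Real.arctan (1 / (2 * t)) := by
    refine Real.arctan_strictMono.monotone ?_
    rw [le_div_iff₀ (by positivity)]; nlinarith
  have h2 : Real.arctan (5 / 4 : ℝ) = π / 2 - Real.arctan (4 / 5) := by
    rw [show (5 / 4 : ℝ) = (4 / 5)⁻¹ by norm_num]; exact Real.arctan_inv_of_pos (by norm_num)
  have h3 : Real.arctan (4 / 5 : ℝ) ≤ 4 / 5 := arctan_le_self (by norm_num)
  have h4 : 0 ≤ 4 / (π ^ 2 * |t ^ 2 - (3 / 2) ^ 2|) := by positivity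
  linarith

/-- The junk value at `t = 1/2` (where the printed `β_e` is undefined and Lean's `4/0 = 0` makes
`β_e(1/2) = π/8`): `π/8 ≤ ½ Im ψ((1/2 + iτ)/2) − (5/16)/(3/2+τ)` for all `τ ≥ 1/2`. [folklore] -/
private theorem rate_even_half {τ : ℝ} (hτ : 1 / 2 ≤ τ) :
    π / 8 ≤ 1 / 2 * (Complex.digamma ((((1 / 2 : ℝ) : ℂ) + τ * I) / 2)).im - 5 / 16 / (3 / 2 + τ) := by
  have hπ := Real.pi_lt_d2
  have hπ' := Real.pi_gt_d2
  rcases le_or_gt (9 / 5 : ℝ) τ with h | h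
  · -- Lehman route beyond 9/5
    have hL := lehman_route (c := 1 / 2) (τ := τ) (by norm_num) (by norm_num) (by linarith)
    have hm := booker_rate_mono (c := 1 / 2) (t := 9 / 5) (τ := τ) (by norm_num) (by norm_num) h
    have ha : Real.arctan (1 / 2 / (9 / 5) : ℝ) ≤ 1 / 2 / (9 / 5) := arctan_le_self (by norm_num)
    have hπ2 : (3.14 : ℝ) ^ 2 < π ^ 2 := by nlinarith
    have hq : 4 / (π ^ 2 * ((9 / 5 : ℝ) ^ 2 - (1 / 2) ^ 2)) ≤ 4 / (3.14 ^ 2 * ((9 / 5 : ℝ) ^ 2 - (1 / 2) ^ 2)) := by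
      apply div_le_div_of_nonneg_left (by norm_num) (by positivity)
      exact mul_le_mul_of_nonneg_right hπ2.le (by norm_num)
    have : π / 8 ≤ π / 4 - 1 / 2 * (1 / 2 / (9 / 5)) - 4 / (3.14 ^ 2 * ((9 / 5 : ℝ) ^ 2 - (1 / 2) ^ 2)) := by
      norm_num; nlinarith
    linarith
  · have h5 : 5 / 16 / (3 / 2 + τ) ≤ 5 / 16 / (3 / 2 + 1 / 2 : ℝ) :=
      div_le_div_of_nonneg_left (by norm_num) (by norm_num) (by linarith)
    rw [half_arg]
    rcases le_or_gt τ 1 with h1 | h1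
    · have hc := im_digamma_ge_cell (x := 1 / 2 / 2) (y := τ / 2) (y₁ := 1 / 4) (y₂ := 1 / 2)
        (by norm_num) (by norm_num) (by linarith) (by linarith) (by norm_num)
      norm_num at hc ⊢
      nlinarith
    · have h5' : 5 / 16 / (3 / 2 + τ) ≤ 5 / 16 / (3 / 2 + 1 : ℝ) :=
        div_le_div_of_nonneg_left (by norm_num) (by norm_num) (by linarith)
      have hc := im_digamma_ge_cell (x := 1 / 2 / 2) (y := τ / 2) (y₁ := 1 / 2) (y₂ := 9 / 10)
        (by norm_num) (by norm_num) (by linarith) (by linarith) (by norm_num)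
      norm_num at hc ⊢
      nlinarith

/-- The junk value at `t = 3/2` (odd case, `β_o(3/2) = π/4 − (3/2)arctan(1/3)` in Lean):
`π/4 − (3/2)arctan(1/3) ≤ ½ Im ψ((3/2 + iτ)/2) − (5/16)/(3/2+τ)` for all `τ ≥ 3/2`. [folklore] -/
private theorem rate_odd_three_halves {τ : ℝ} (hτ : 3 / 2 ≤ τ) :
    π / 4 - 3 / 2 * Real.arctan (1 / 3) ≤
      1 / 2 * (Complex.digamma ((((3 / 2 : ℝ) : ℂ) + τ * I) / 2)).im - 5 / 16 / (3 / 2 + τ) := by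
  have hπ := Real.pi_lt_d2
  have hπ' := Real.pi_gt_d2
  have ha3 : (3 / 10 : ℝ) ≤ Real.arctan (1 / 3) := by
    have := Literature.Analysis.SpecialFunctions.DigammaLehman.div_one_add_sq_le_arctan
      (v := (1 / 3 : ℝ)) (by norm_num)
    norm_num at this ⊢; linarith
  rcases le_or_gt (3 : ℝ) τ with h | h
  · have hL := lehman_route (c := 3 / 2) (τ := τ) (by norm_num) (by norm_num) (by linarith)
    have hm := booker_rate_mono (c := 3 / 2) (t := 3) (τ := τ) (by norm_num) (by norm_num) h
    have ha : Real.arctan (3 / 2 / 3 : ℝ) ≤ 3 / 2 / 3 := arctan_le_self (by norm_num)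
    have hπ2 : (3.14 : ℝ) ^ 2 < π ^ 2 := by nlinarith
    have hq : 4 / (π ^ 2 * ((3 : ℝ) ^ 2 - (3 / 2) ^ 2)) ≤ 4 / (3.14 ^ 2 * ((3 : ℝ) ^ 2 - (3 / 2) ^ 2)) := by
      apply div_le_div_of_nonneg_left (by norm_num) (by positivity)
      exact mul_le_mul_of_nonneg_right hπ2.le (by norm_num)
    have : (9 / 20 : ℝ) ≥ 1 / 2 * (3 / 2 / 3) + 4 / (3.14 ^ 2 * ((3 : ℝ) ^ 2 - (3 / 2) ^ 2)) := by
      norm_num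
    linarith
  · rw [half_arg]
    rcases le_or_gt τ 2 with h1 | h1
    · have h5 : 5 / 16 / (3 / 2 + τ) ≤ 5 / 16 / (3 / 2 + 3 / 2 : ℝ) :=
        div_le_div_of_nonneg_left (by norm_num) (by norm_num) (by linarith)
      have hc := im_digamma_ge_cell (x := 3 / 2 / 2) (y := τ / 2) (y₁ := 3 / 4) (y₂ := 1)
        (by norm_num) (by norm_num) (by linarith) (by linarith) (by norm_num)
      norm_num at hc ⊢
      nlinarith
    rcases le_or_gt τ (5 / 2) with h2 | h2
    · have h5 : 5 / 16 / (3 / 2 + τ) ≤ 5 / 16 / (3 / 2 + 2 : ℝ) :=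
        div_le_div_of_nonneg_left (by norm_num) (by norm_num) (by linarith)
      have hc := im_digamma_ge_cell (x := 3 / 2 / 2) (y := τ / 2) (y₁ := 1) (y₂ := 5 / 4)
        (by norm_num) (by norm_num) (by linarith) (by linarith) (by norm_num)
      norm_num at hc ⊢
      nlinarith
    · have h5 : 5 / 16 / (3 / 2 + τ) ≤ 5 / 16 / (3 / 2 + 5 / 2 : ℝ) :=
        div_le_div_of_nonneg_left (by norm_num) (by norm_num) (by linarith)
      have hc := im_digamma_ge_cell (x := 3 / 2 / 2) (y := τ / 2) (y₁ := 5 / 4) (y₂ := 3 / 2)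
        (by norm_num) (by norm_num) (by linarith) (by linarith) (by norm_num)
      norm_num at hc ⊢
      nlinarith

/-- **The rate inequality** behind Booker 2006 Lemma 5.7 / Platt 2016 Lemma 7.6 for Dirichlet
`L`-functions (`c = 1/2` even, `c = 3/2` odd), with Platt's `β`:
for `0 < t ≤ τ`, `π/4 − c·arctan(1/(2t)) − 4/(π²|t² − c²|) ≤ ½ Im ψ((c+iτ)/2) − (5/16)/(3/2+τ)`
— Booker's "`−kB Im(γ'/γ + ½Q'/Q)(s*) ≤ … ≤ −βkB`" per unit length, with Platt's Lemma 7.3 growth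
`(5/16)/(3/2+τ)` in place of `½ Im Q'/Q` and Platt's `β` (Lean's `4/0 = 0` at `t = c` included; the range
`t < c`, not covered by the printed argument, by positivity of `Im ψ`). [cite: Booker2006, proof of Lemma 5.7]
[cite: Platt2016GRH, proof of Lemma 7.6 p. 3020] -/
theorem rate {c : ℝ} (hc : c = 1 / 2 ∨ c = 3 / 2) {t τ : ℝ} (ht : 0 < t) (htτ : t ≤ τ) :
    π / 4 - c * Real.arctan (1 / (2 * t)) - 4 / (π ^ 2 * |t ^ 2 - c ^ 2|) ≤
      1 / 2 * (Complex.digamma (((c : ℂ) + τ * I) / 2)).im - 5 / 16 / (3 / 2 + τ) := by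
  have hτ : 0 < τ := ht.trans_le htτ
  have hc0 : 0 < c := by rcases hc with rfl | rfl <;> norm_num
  have hc1 : c ≤ 3 / 2 := by rcases hc with rfl | rfl <;> norm_num
  rcases lt_trichotomy c t with hct | hct | hct
  · -- `t > c`: Booker's argument verbatim
    have hL := lehman_route hc0 hc1 (hct.trans_le htτ)
    have hm := booker_rate_mono hc0 hct htτ
    rw [abs_of_pos (by nlinarith : 0 < t ^ 2 - c ^ 2)]
    have hP : 1 / 2 * Real.arctan (c / t) ≤ c * Real.arctan (1 / (2 * t)) := by
      rcases hc with rfl | rfl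
      · rw [show (1 / 2 : ℝ) / t = 1 / (2 * t) by field_simp]
      · rw [show (3 / 2 : ℝ) / t = 3 * (1 / (2 * t)) by field_simp]
        have := arctan_three_mul_le (u := 1 / (2 * t)) (by positivity)
        linarith
    linarith
  · -- `t = c`: the junk value
    subst hct
    rw [sub_self, abs_zero, mul_zero, div_zero, sub_zero]
    rcases hc with rfl | rfl
    · have e : π / 4 - 1 / 2 * Real.arctan (1 / (2 * (1 / 2))) = π / 8 := by
        rw [show (1 : ℝ) / (2 * (1 / 2)) = 1 by norm_num, Real.arctan_one]; ring
      rw [e]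
      have := rate_even_half htτ
      simpa using this
    · rw [show (1 : ℝ) / (2 * (3 / 2)) = 1 / 3 by norm_num]
      have := rate_odd_three_halves htτ
      simpa using this
  · -- `t < c`: the gap in the printed proof; closed by `Im ψ ≥ 0` / the first series term
    rcases hc with rfl | rfl
    · exact (beta_even_small ht hct).trans (rate_ge_neg (by norm_num) hτ)
    · rcases le_or_gt (2 / 5 : ℝ) τ with h25 | h25
      · have h1 := beta_odd_neg ht hct
        have h2 := rate_odd_nonneg h25
        linarith
      · exact (beta_odd_small ht (htτ.trans_lt h25)).trans (rate_ge_neg (by norm_num) hτ)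

/-! ## §5 Monotone decay of the majorant (the mean-value step of Booker's proof) -/

/-- **Decay of Platt's majorant along the sampling progression.** For `c ∈ {1/2, 3/2}` and
`0 < t ≤ τ`, with Platt's `β(t) = π/4 − c·arctan(1/(2t)) − 4/(π²|t² − c²|)`:
`‖Γ((c+iτ)/2)‖ (3/2+τ)^{5/16} ≤ ‖Γ((c+it)/2)‖ (3/2+t)^{5/16} e^{−β(t)(τ−t)}` — Booker's
"`log(|γ(s+ikB)/γ(s)| |Q(s+ikB)/Q(s)|^{1/2}) = −kB Im(γ'/γ + ½Q'/Q)(s*) ≤ −βkB`" with Platt's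
`(3/2+|t|)^{5/16}` (Lemma 7.3) in place of `|Q(s)|^{1/2}`, via `φ(u) = log‖Γ‖ + (5/16)log(3/2+u) + βu`
antitone on `[t, ∞)` (`φ' ≤ 0` is `TimeAliasing.rate`). [cite: Booker2006, proof of Lemma 5.7]
[cite: Platt2016GRH, proof of Lemma 7.6 p. 3020] -/
theorem decay {c : ℝ} (hc : c = 1 / 2 ∨ c = 3 / 2) {t τ : ℝ} (ht : 0 < t) (htτ : t ≤ τ) :
    ‖Complex.Gamma (((c : ℂ) + τ * I) / 2)‖ * (3 / 2 + τ) ^ ((5 : ℝ) / 16) ≤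
      ‖Complex.Gamma (((c : ℂ) + t * I) / 2)‖ * (3 / 2 + t) ^ ((5 : ℝ) / 16) *
        Real.exp (-(π / 4 - c * Real.arctan (1 / (2 * t)) - 4 / (π ^ 2 * |t ^ 2 - c ^ 2|)) *
          (τ - t)) := by
  have hc0 : 0 < c := by rcases hc with rfl | rfl <;> norm_num
  have hτ : 0 < τ := ht.trans_le htτ
  set b : ℝ := π / 4 - c * Real.arctan (1 / (2 * t)) - 4 / (π ^ 2 * |t ^ 2 - c ^ 2|) with hb
  set φ : ℝ → ℝ := fun u => Real.log ‖Complex.Gamma (((c : ℂ) + u * I) / 2)‖ +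
    5 / 16 * Real.log (3 / 2 + u) + b * u with hφ
  set φ' : ℝ → ℝ := fun u => -(1 / 2) * (Complex.digamma (((c : ℂ) + u * I) / 2)).im +
    5 / 16 * (1 / (3 / 2 + u)) + b * 1 with hφ'
  have hderiv : ∀ u : ℝ, 0 < u → HasDerivAt φ (φ' u) u := by
    intro u hu
    have h1 := hasDerivAt_log_norm_Gamma hc0 u
    have h2 : HasDerivAt (fun u : ℝ => 5 / 16 * Real.log (3 / 2 + u)) (5 / 16 * (1 / (3 / 2 + u))) u := by
      have h := ((hasDerivAt_id u).const_add (3 / 2 : ℝ)).log (by simp; linarith)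
      simp only [id] at h
      have := h.const_mul (5 / 16 : ℝ)
      simpa using this
    have h3 : HasDerivAt (fun u : ℝ => b * u) (b * 1) u := (hasDerivAt_id u).const_mul b
    exact (h1.add h2).add h3
  have hanti : AntitoneOn φ (Ici t) := by
    refine antitoneOn_of_hasDerivWithinAt_nonpos (convex_Ici t) (f' := φ')
      (fun u hu => (hderiv u (ht.trans_le hu)).continuousAt.continuousWithinAt)
      (fun u hu => (hderiv u ?_).hasDerivWithinAt) ?_
    · rw [interior_Ici] at hu; exact ht.trans hu
    · intro u hu
      rw [interior_Ici] at hu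
      have hr := rate hc ht (le_of_lt hu)
      show -(1 / 2) * (Complex.digamma (((c : ℂ) + u * I) / 2)).im + 5 / 16 * (1 / (3 / 2 + u)) +
        b * 1 ≤ 0
      have : 5 / 16 * (1 / (3 / 2 + u)) = 5 / 16 / (3 / 2 + u) := by ring
      linarith
  have hφle : φ τ ≤ φ t := hanti self_mem_Ici (show τ ∈ Ici t from htτ) htτ
  have hexp : ∀ u : ℝ, 0 < u → Real.exp (φ u) =
      ‖Complex.Gamma (((c : ℂ) + u * I) / 2)‖ * (3 / 2 + u) ^ ((5 : ℝ) / 16) * Real.exp (b * u) := by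
    intro u hu
    have hΓ : 0 < ‖Complex.Gamma (((c : ℂ) + u * I) / 2)‖ :=
      norm_pos_iff.mpr (Complex.Gamma_ne_zero_of_re_pos (by simp; positivity))
    simp only [hφ]
    rw [Real.exp_add, Real.exp_add, Real.exp_log hΓ, Real.rpow_def_of_pos (by linarith),
      mul_comm (Real.log (3 / 2 + u))]
  calc ‖Complex.Gamma (((c : ℂ) + τ * I) / 2)‖ * (3 / 2 + τ) ^ ((5 : ℝ) / 16)
      = Real.exp (φ τ) * Real.exp (-(b * τ)) := by
        rw [hexp τ hτ, mul_assoc, ← Real.exp_add, add_neg_cancel, Real.exp_zero, mul_one]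
    _ ≤ Real.exp (φ t) * Real.exp (-(b * τ)) := by gcongr
    _ = ‖Complex.Gamma (((c : ℂ) + t * I) / 2)‖ * (3 / 2 + t) ^ ((5 : ℝ) / 16) *
        Real.exp (-b * (τ - t)) := by
        rw [hexp t ht, mul_assoc, ← Real.exp_add]; congr 1; congr 1; ring

/-- `‖Γ((c + iu)/2)‖ = ‖Γ((c + i|u|)/2)‖` (`Γ(conj z) = conj Γ(z)`, `c` real). [folklore] -/
private theorem norm_Gamma_abs (c u : ℝ) :
    ‖Complex.Gamma (((c : ℂ) + u * I) / 2)‖ = ‖Complex.Gamma (((c : ℂ) + |u| * I) / 2)‖ := by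
  rcases le_or_gt 0 u with hu | hu
  · rw [abs_of_nonneg hu]
  · rw [abs_of_neg hu]
    have : ((c : ℂ) + u * I) / 2 = (starRingEnd ℂ) (((c : ℂ) + ((-u : ℝ) : ℂ) * I) / 2) := by
      simp only [map_div₀, map_add, Complex.conj_ofReal, map_mul, Complex.conj_I, map_ofNat]
      push_cast; ring
    rw [this, Complex.Gamma_conj, Complex.norm_conj]

/-! ## §6 The one-sided aliasing sums (Booker 2006 Lemma 5.7 (i)/(ii) for Dirichlet `L`) -/

/-- **The right tail, `t > 0`** (shape of Booker's Lemma 5.7 (i)): if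
`‖F(u)‖ ≤ K ‖Γ((c+i|u|)/2)‖ (3/2+|u|)^{5/16} e^{πηu/4}` for all real `u` (`K ≥ 0`, `c ∈ {1/2, 3/2}`),
then for `t > 0`, `B > 0` and `β(t) − πη/4 > 0`,
`Σ_{k ≥ 0} F(t + kB)` converges absolutely and
`‖Σ_{k ≥ 0} F(t + kB)‖ ≤ K ‖Γ((c+it)/2)‖ (3/2+t)^{5/16} e^{πηt/4} / (1 − e^{−B(β(t) − πη/4)})`.
[cite: Booker2006, Lemma 5.7 (i)] [cite: Platt2016GRH, proof of Lemma 7.6 p. 3020] -/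
theorem tail_right {c : ℝ} (hc : c = 1 / 2 ∨ c = 3 / 2) {K η : ℝ} (hK : 0 ≤ K) (F : ℝ → ℂ)
    (hF : ∀ u : ℝ, ‖F u‖ ≤ K * ‖Complex.Gamma (((c : ℂ) + |u| * I) / 2)‖ *
      (3 / 2 + |u|) ^ ((5 : ℝ) / 16) * Real.exp (π * η * u / 4))
    {t B β : ℝ} (ht : 0 < t) (hB : 0 < B)
    (hβ : β = π / 4 - c * Real.arctan (1 / (2 * t)) - 4 / (π ^ 2 * |t ^ 2 - c ^ 2|))
    (hβη : π / 4 * η < β) :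
    Summable (fun k : ℕ => F (t + k * B)) ∧
      ‖∑' k : ℕ, F (t + k * B)‖ ≤ K * ‖Complex.Gamma (((c : ℂ) + t * I) / 2)‖ *
        (3 / 2 + t) ^ ((5 : ℝ) / 16) * Real.exp (π * η * t / 4) /
          (1 - Real.exp (-(B * (β - π / 4 * η)))) := by
  set M : ℝ := K * ‖Complex.Gamma (((c : ℂ) + t * I) / 2)‖ * (3 / 2 + t) ^ ((5 : ℝ) / 16) *
    Real.exp (π * η * t / 4) with hM
  set r : ℝ := Real.exp (-(B * (β - π / 4 * η))) with hr
  have hr0 : 0 ≤ r := (Real.exp_pos _).le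
  have hr1 : r < 1 := by rw [hr, Real.exp_lt_one_iff]; nlinarith
  have hterm : ∀ k : ℕ, ‖F (t + k * B)‖ ≤ M * r ^ k := by
    intro k
    have hk : (0 : ℝ) ≤ k * B := by positivity
    have hu : 0 < t + k * B := by linarith
    refine (hF _).trans ?_
    rw [abs_of_pos hu]
    have hd := decay hc ht (show t ≤ t + k * B by linarith)
    rw [← hβ, show t + k * B - t = k * B by ring] at hd
    have e : Real.exp (π * η * (t + k * B) / 4) =
        Real.exp (π * η * t / 4) * Real.exp (π / 4 * η * (k * B)) := by
      rw [← Real.exp_add]; congr 1; ring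
    have er : r ^ k = Real.exp (-β * (k * B)) * Real.exp (π / 4 * η * (k * B)) := by
      rw [hr, ← Real.exp_nat_mul, ← Real.exp_add]; congr 1; ring
    rw [e, er, hM]
    have hG := mul_le_mul_of_nonneg_left hd hK
    calc K * ‖Complex.Gamma (((c : ℂ) + (t + k * B : ℝ) * I) / 2)‖ *
          (3 / 2 + (t + k * B)) ^ ((5 : ℝ) / 16) *
          (Real.exp (π * η * t / 4) * Real.exp (π / 4 * η * (k * B)))
        = (K * (‖Complex.Gamma (((c : ℂ) + (t + k * B : ℝ) * I) / 2)‖ *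
          (3 / 2 + (t + k * B)) ^ ((5 : ℝ) / 16))) *
          (Real.exp (π * η * t / 4) * Real.exp (π / 4 * η * (k * B))) := by ring
      _ ≤ (K * (‖Complex.Gamma (((c : ℂ) + t * I) / 2)‖ * (3 / 2 + t) ^ ((5 : ℝ) / 16) *
          Real.exp (-β * (k * B)))) *
          (Real.exp (π * η * t / 4) * Real.exp (π / 4 * η * (k * B))) := by
          gcongr
      _ = _ := by ring
  have hgeom : HasSum (fun k : ℕ => M * r ^ k) (M / (1 - r)) := by
    have := (hasSum_geometric_of_lt_one hr0 hr1).mul_left M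
    simpa [div_eq_mul_inv] using this
  have hsum : Summable (fun k : ℕ => F (t + k * B)) :=
    Summable.of_norm_bounded hgeom.summable hterm
  refine ⟨hsum, ?_⟩
  calc ‖∑' k : ℕ, F (t + k * B)‖ ≤ ∑' k : ℕ, ‖F (t + k * B)‖ := norm_tsum_le_tsum_norm hsum.norm
    _ ≤ ∑' k : ℕ, M * r ^ k := hsum.norm.tsum_le_tsum hterm hgeom.summable
    _ = M / (1 - r) := hgeom.tsum_eq

/-- **The left tail, `t < 0`** (shape of Booker's Lemma 5.7 (ii)): under the same majorant, for
`t < 0`, `B > 0` and `β(t) + πη/4 > 0` (`β` depends on `|t|` only),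
`‖Σ_{k ≥ 0} F(t − kB)‖ ≤ K ‖Γ((c+it)/2)‖ (3/2+|t|)^{5/16} e^{πηt/4} / (1 − e^{−B(β(t) + πη/4)})`
(apply the right-tail decay to `|t| + kB` with `η ↦ −η`). [cite: Booker2006, Lemma 5.7 (ii)] -/
theorem tail_left {c : ℝ} (hc : c = 1 / 2 ∨ c = 3 / 2) {K η : ℝ} (hK : 0 ≤ K) (F : ℝ → ℂ)
    (hF : ∀ u : ℝ, ‖F u‖ ≤ K * ‖Complex.Gamma (((c : ℂ) + |u| * I) / 2)‖ *
      (3 / 2 + |u|) ^ ((5 : ℝ) / 16) * Real.exp (π * η * u / 4))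
    {t B β : ℝ} (ht : t < 0) (hB : 0 < B)
    (hβ : β = π / 4 - c * Real.arctan (1 / (2 * |t|)) - 4 / (π ^ 2 * |t ^ 2 - c ^ 2|))
    (hβη : -(π / 4 * η) < β) :
    Summable (fun k : ℕ => F (t - k * B)) ∧
      ‖∑' k : ℕ, F (t - k * B)‖ ≤ K * ‖Complex.Gamma (((c : ℂ) + t * I) / 2)‖ *
        (3 / 2 + |t|) ^ ((5 : ℝ) / 16) * Real.exp (π * η * t / 4) /
          (1 - Real.exp (-(B * (β + π / 4 * η)))) := by
  set s : ℝ := -t with hs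
  have hs0 : 0 < s := by rw [hs]; linarith
  have hts : |t| = s := by rw [hs]; exact abs_of_neg ht
  set M : ℝ := K * ‖Complex.Gamma (((c : ℂ) + t * I) / 2)‖ * (3 / 2 + |t|) ^ ((5 : ℝ) / 16) *
    Real.exp (π * η * t / 4) with hM
  set r : ℝ := Real.exp (-(B * (β + π / 4 * η))) with hr
  have hr0 : 0 ≤ r := (Real.exp_pos _).le
  have hr1 : r < 1 := by rw [hr, Real.exp_lt_one_iff]; nlinarith
  have hβ' : β = π / 4 - c * Real.arctan (1 / (2 * s)) - 4 / (π ^ 2 * |s ^ 2 - c ^ 2|) := by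
    rw [hβ, hts, hs, neg_sq]
  have hterm : ∀ k : ℕ, ‖F (t - k * B)‖ ≤ M * r ^ k := by
    intro k
    have hk : (0 : ℝ) ≤ k * B := by positivity
    have hu : t - k * B < 0 := by linarith
    have habs : |t - k * B| = s + k * B := by rw [abs_of_neg hu, hs]; ring
    refine (hF _).trans ?_
    rw [habs]
    have hd := decay hc hs0 (show s ≤ s + k * B by linarith)
    rw [← hβ', show s + k * B - s = k * B by ring] at hd
    have e : Real.exp (π * η * (t - k * B) / 4) =
        Real.exp (π * η * t / 4) * Real.exp (-(π / 4 * η * (k * B))) := by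
      rw [← Real.exp_add]; congr 1; ring
    have er : r ^ k = Real.exp (-β * (k * B)) * Real.exp (-(π / 4 * η * (k * B))) := by
      rw [hr, ← Real.exp_nat_mul, ← Real.exp_add]; congr 1; ring
    have hGt : ‖Complex.Gamma (((c : ℂ) + t * I) / 2)‖ = ‖Complex.Gamma (((c : ℂ) + s * I) / 2)‖ := by
      rw [norm_Gamma_abs, hts]
    rw [e, er, hM, hGt, hts]
    have hG := mul_le_mul_of_nonneg_left hd hK
    calc K * ‖Complex.Gamma (((c : ℂ) + (s + k * B : ℝ) * I) / 2)‖ *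
          (3 / 2 + (s + k * B)) ^ ((5 : ℝ) / 16) *
          (Real.exp (π * η * t / 4) * Real.exp (-(π / 4 * η * (k * B))))
        = (K * (‖Complex.Gamma (((c : ℂ) + (s + k * B : ℝ) * I) / 2)‖ *
          (3 / 2 + (s + k * B)) ^ ((5 : ℝ) / 16))) *
          (Real.exp (π * η * t / 4) * Real.exp (-(π / 4 * η * (k * B)))) := by ring
      _ ≤ (K * (‖Complex.Gamma (((c : ℂ) + s * I) / 2)‖ * (3 / 2 + s) ^ ((5 : ℝ) / 16) *
          Real.exp (-β * (k * B)))) *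
          (Real.exp (π * η * t / 4) * Real.exp (-(π / 4 * η * (k * B)))) := by
          gcongr
      _ = _ := by ring
  have hgeom : HasSum (fun k : ℕ => M * r ^ k) (M / (1 - r)) := by
    have := (hasSum_geometric_of_lt_one hr0 hr1).mul_left M
    simpa [div_eq_mul_inv] using this
  have hsum : Summable (fun k : ℕ => F (t - k * B)) :=
    Summable.of_norm_bounded hgeom.summable hterm
  refine ⟨hsum, ?_⟩
  calc ‖∑' k : ℕ, F (t - k * B)‖ ≤ ∑' k : ℕ, ‖F (t - k * B)‖ := norm_tsum_le_tsum_norm hsum.norm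
    _ ≤ ∑' k : ℕ, M * r ^ k := hsum.norm.tsum_le_tsum hterm hgeom.summable
    _ = M / (1 - r) := hgeom.tsum_eq

/-- `‖Σ_{k ∈ ℤ} G(k) - G(0)‖ ≤ ‖Σ_{j ≥ 0} G(j+1)‖ + ‖Σ_{j ≥ 0} G(-(j+1))‖` and summability over `ℤ`, when
both tails are summable (Mathlib's `tsum_of_nat_of_neg_add_one`). [folklore] -/
private theorem summable_int_and_norm_tsum_sub_le (G : ℤ → ℂ) (hs1 : Summable fun j : ℕ => G ((j : ℤ) + 1))
    (hs2 : Summable fun j : ℕ => G (-((j : ℤ) + 1))) :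
    Summable G ∧
      ‖(∑' k : ℤ, G k) - G 0‖ ≤ ‖∑' j : ℕ, G ((j : ℤ) + 1)‖ + ‖∑' j : ℕ, G (-((j : ℤ) + 1))‖ := by
  have hs1' : Summable fun j : ℕ => G (j : ℤ) := by
    have : Summable fun j : ℕ => G ((j + 1 : ℕ) : ℤ) := by simpa [Nat.cast_succ] using hs1
    exact (summable_nat_add_iff 1).mp this
  refine ⟨Summable.of_nat_of_neg_add_one hs1' hs2, ?_⟩
  rw [tsum_of_nat_of_neg_add_one hs1' hs2, hs1'.tsum_eq_zero_add]
  simp only [Nat.cast_zero, Nat.cast_succ]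
  have : G 0 + ∑' j : ℕ, G ((j : ℤ) + 1) + ∑' j : ℕ, G (-((j : ℤ) + 1)) - G 0 =
      ∑' j : ℕ, G ((j : ℤ) + 1) + ∑' j : ℕ, G (-((j : ℤ) + 1)) := by ring
  rw [this]
  exact norm_add_le _ _

/-! ## §7 The `L`-function layer: `|F(t, χ)| ≤ E(t)` (Platt's Lemma 7.3) -/

/-- The size of Platt's `F(t, χ) = ε_χ q^{it/2} π^{-(c+it)/2} Γ((c+it)/2) e^{πηt/4} L_χ(1/2+it)`
(`c = 1/2` for `F_e`, `3/2` for `F_o`, p. 3017) is at most Platt's `E(t)` with `(3/2 + |t|)^{5/16}`: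
`‖F(t, χ)‖ ≤ ζ(9/8) π^{-c/2} ‖Γ((c+i|t|)/2)‖ e^{πηt/4} ((q/2π)(3/2 + |t|))^{5/16}` — from `|ε_χ| = 1`,
`|q^{it/2}| = 1`, `|π^{-(c+it)/2}| = π^{-c/2}`, `|Γ(conj z)| = |Γ(z)|` and Lemma 7.3
(`platt2016_lemma73`). [cite: Platt2016GRH, Lemma 7.3 p. 3019 and proof of Lemma 7.6 p. 3020] -/
theorem norm_F_le {q : ℕ} [NeZero q] (hq : 1 < q) {χ : DirichletCharacter ℂ q}
    (hχ : χ.IsPrimitive) (c : ℝ) {ε : ℂ} (hε : ‖ε‖ = 1) (η u : ℝ) :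
    ‖ε * (q : ℂ) ^ (I * u / 2) * (π : ℂ) ^ (-((c : ℂ) + I * u) / 2) *
        Complex.Gamma (((c : ℂ) + I * u) / 2) * Complex.exp (π * η * u / 4) *
        χ.LFunction (1 / 2 + I * u)‖ ≤
      Booker2006Turing.bigZ (9 / 8) * π ^ (-(c / 2)) * ((q : ℝ) / (2 * π)) ^ ((5 : ℝ) / 16) *
        ‖Complex.Gamma (((c : ℂ) + |u| * I) / 2)‖ * (3 / 2 + |u|) ^ ((5 : ℝ) / 16) *
        Real.exp (π * η * u / 4) := by
  have hq0 : (0 : ℝ) < q := by exact_mod_cast (by omega : 0 < q)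
  have n1 : ‖(q : ℂ) ^ (I * u / 2)‖ = 1 := by
    rw [show (q : ℂ) = ((q : ℝ) : ℂ) by norm_cast, Complex.norm_cpow_eq_rpow_re_of_pos hq0]
    simp
  have n2 : ‖(π : ℂ) ^ (-((c : ℂ) + I * u) / 2)‖ = π ^ (-(c / 2)) := by
    rw [Complex.norm_cpow_eq_rpow_re_of_pos Real.pi_pos]
    congr 1
    simp
    ring
  have n3 : ‖Complex.Gamma (((c : ℂ) + I * u) / 2)‖ = ‖Complex.Gamma (((c : ℂ) + |u| * I) / 2)‖ := by
    rw [mul_comm I, norm_Gamma_abs]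
  have n4 : ‖Complex.exp (π * η * u / 4)‖ = Real.exp (π * η * u / 4) := by
    rw [Complex.norm_exp]
    congr 1
    rw [show (π : ℂ) * η * u / 4 = ((π * η * u / 4 : ℝ) : ℂ) by push_cast; ring, Complex.ofReal_re]
  have hL := platt2016_lemma73 hq hχ u
  rw [mul_comm (u : ℂ) I] at hL
  have hZ : 0 < Booker2006Turing.bigZ (9 / 8) := Booker2006Turing.bigZ_pos (by norm_num)
  rw [norm_mul, norm_mul, norm_mul, norm_mul, norm_mul, hε, n1, n2, n3, n4, one_mul, one_mul]
  have hG : 0 ≤ ‖Complex.Gamma (((c : ℂ) + |u| * I) / 2)‖ := norm_nonneg _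
  calc π ^ (-(c / 2)) * ‖Complex.Gamma (((c : ℂ) + |u| * I) / 2)‖ * Real.exp (π * η * u / 4) *
        ‖χ.LFunction (1 / 2 + I * u)‖
      ≤ π ^ (-(c / 2)) * ‖Complex.Gamma (((c : ℂ) + |u| * I) / 2)‖ * Real.exp (π * η * u / 4) *
        (Booker2006Turing.bigZ (9 / 8) * ((q : ℝ) / (2 * π)) ^ ((5 : ℝ) / 16) *
          (3 / 2 + |u|) ^ ((5 : ℝ) / 16)) := by
        gcongr
    _ = _ := by ring

end TimeAliasing

/-! ## §8 Platt 2016, Lemma 7.6 (time-domain aliasing), corrected form -/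

open TimeAliasing in
/-- **Platt 2016, Lemma 7.6, both parities** (`c = 1/2`: `F_e`, even `χ`; `c = 3/2`: `F_o`, odd `χ`),
in the CORRECTED form proved here (see `platt2016_lemma76_even` for the text). With
`F(t, χ) = ε_χ q^{it/2} π^{-(c+it)/2} Γ((c+it)/2) e^{πηt/4} L_χ(1/2 + it)`,
`E(t) = ζ(9/8) π^{-c/2} |Γ((c+it)/2)| e^{πηt/4} ((q/2π)(3/2 + |t|))^{5/16}`,
`β(t) = π/4 − c·arctan(1/(2|t|)) − 4/(π²|t² − c²|)` (Platt: `½ arctan` for `F_e`, `(3/2) arctan` for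
`F_o`), `A, B > 0`, `0 ≤ m < AB`, `β(m/A + B) > πη/4` and `β(m/A − B) > −πη/4`:
`Σ_{k ∈ ℤ} F(m/A + kB, χ)` converges absolutely and
`|F̃(m, χ) − F(m/A, χ)| ≤ E(m/A + B)/(1 − e^{−B(β(m/A+B) − πη/4)}) + E(m/A − B)/(1 − e^{−B(β(m/A−B) + πη/4)})`,
`F̃(m, χ) := Σ_{k ∈ ℤ} F(m/A + kB, χ)` (p. 3017). The parity of `χ`, `|η| < 1` and the realness of `F`
are not used. [cite: Platt2016GRH, Lemma 7.6 pp. 3019–3020] [cite: Booker2006, Lemma 5.7] -/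
theorem platt2016_lemma76 {q : ℕ} [NeZero q] (hq : 1 < q) {χ : DirichletCharacter ℂ q}
    (hχ : χ.IsPrimitive) {c : ℝ} (hc : c = 1 / 2 ∨ c = 3 / 2) {ε : ℂ} (hε : ‖ε‖ = 1) (η : ℝ)
    (F : ℝ → ℂ) (hF : ∀ u : ℝ, F u = ε * (q : ℂ) ^ (I * u / 2) * (π : ℂ) ^ (-((c : ℂ) + I * u) / 2) *
        Complex.Gamma (((c : ℂ) + I * u) / 2) * Complex.exp (π * η * u / 4) *
        χ.LFunction (1 / 2 + I * u))
    (E : ℝ → ℝ) (hE : ∀ u : ℝ, E u = Booker2006Turing.bigZ (9 / 8) * π ^ (-(c / 2)) *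
        ‖Complex.Gamma (((c : ℂ) + I * u) / 2)‖ * Real.exp (π * η * u / 4) *
        ((q : ℝ) / (2 * π) * (3 / 2 + |u|)) ^ ((5 : ℝ) / 16))
    (β : ℝ → ℝ) (hβ : ∀ u : ℝ, β u = π / 4 - c * Real.arctan (1 / (2 * |u|)) -
        4 / (π ^ 2 * |u ^ 2 - c ^ 2|))
    {A B : ℝ} (hA : 0 < A) (hB : 0 < B) (m : ℤ) (hm : 0 ≤ m) (hmN : (m : ℝ) < A * B)
    (hβp : π / 4 * η < β (m / A + B)) (hβm : -(π / 4 * η) < β (m / A - B)) :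
    Summable (fun k : ℤ => F (m / A + k * B)) ∧
      ‖(∑' k : ℤ, F (m / A + k * B)) - F (m / A)‖ ≤
        E (m / A + B) / (1 - Real.exp (-(B * (β (m / A + B) - π / 4 * η)))) +
          E (m / A - B) / (1 - Real.exp (-(B * (β (m / A - B) + π / 4 * η)))) := by
  have hc0 : 0 < c := by rcases hc with rfl | rfl <;> norm_num
  have hq0 : (0 : ℝ) < q := by exact_mod_cast (by omega : 0 < q)
  have hmA : (0 : ℝ) ≤ m / A := div_nonneg (by exact_mod_cast hm) hA.le
  have hmB : (m : ℝ) / A < B := by rw [div_lt_iff₀ hA]; linarith [mul_comm A B]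
  have htp : 0 < (m : ℝ) / A + B := by linarith
  have htm : (m : ℝ) / A - B < 0 := by linarith
  set K : ℝ := Booker2006Turing.bigZ (9 / 8) * π ^ (-(c / 2)) * ((q : ℝ) / (2 * π)) ^ ((5 : ℝ) / 16)
    with hK
  have hK0 : 0 ≤ K := by
    have := Booker2006Turing.bigZ_pos (σ := 9 / 8) (by norm_num)
    positivity
  have hFK : ∀ u : ℝ, ‖F u‖ ≤ K * ‖Complex.Gamma (((c : ℂ) + |u| * I) / 2)‖ *
      (3 / 2 + |u|) ^ ((5 : ℝ) / 16) * Real.exp (π * η * u / 4) := by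
    intro u; rw [hF u]; exact norm_F_le hq hχ c hε η u
  -- `E` in the engine's form
  have hE' : ∀ u : ℝ, E u = K * ‖Complex.Gamma (((c : ℂ) + u * I) / 2)‖ *
      (3 / 2 + |u|) ^ ((5 : ℝ) / 16) * Real.exp (π * η * u / 4) := by
    intro u
    rw [hE u, hK, mul_comm I, Real.mul_rpow (by positivity) (by positivity)]
    ring
  -- the two tails
  obtain ⟨hsp, hbp⟩ := tail_right hc hK0 F hFK htp hB (β := β (m / A + B))
    (by rw [hβ, abs_of_pos htp]) hβp
  obtain ⟨hsm, hbm⟩ := tail_left hc hK0 F hFK htm hB (β := β (m / A - B)) (hβ _) hβm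
  have ep : K * ‖Complex.Gamma (((c : ℂ) + ((m : ℝ) / A + B : ℝ) * I) / 2)‖ *
      (3 / 2 + ((m : ℝ) / A + B)) ^ ((5 : ℝ) / 16) * Real.exp (π * η * ((m : ℝ) / A + B) / 4) =
      E (m / A + B) := by
    rw [hE' ((m : ℝ) / A + B), abs_of_pos htp]
  have em : K * ‖Complex.Gamma (((c : ℂ) + ((m : ℝ) / A - B : ℝ) * I) / 2)‖ *
      (3 / 2 + |(m : ℝ) / A - B|) ^ ((5 : ℝ) / 16) * Real.exp (π * η * ((m : ℝ) / A - B) / 4) =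
      E (m / A - B) := by
    rw [hE' ((m : ℝ) / A - B)]
  rw [ep] at hbp
  rw [em] at hbm
  -- fold the `ℤ`-sum
  set G : ℤ → ℂ := fun k => F (m / A + k * B) with hG
  have hG1 : ∀ j : ℕ, G ((j : ℤ) + 1) = F (m / A + B + j * B) := by
    intro j; simp only [hG]; congr 1; push_cast; ring
  have hG2 : ∀ j : ℕ, G (-((j : ℤ) + 1)) = F (m / A - B - j * B) := by
    intro j; simp only [hG]; congr 1; push_cast; ring
  have hs1 : Summable fun j : ℕ => G ((j : ℤ) + 1) := by simp_rw [hG1]; exact hsp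
  have hs2 : Summable fun j : ℕ => G (-((j : ℤ) + 1)) := by simp_rw [hG2]; exact hsm
  obtain ⟨hsum, hle⟩ := summable_int_and_norm_tsum_sub_le G hs1 hs2
  have hG0 : G 0 = F (m / A) := by simp [hG]
  refine ⟨hsum, ?_⟩
  rw [hG0] at hle
  simp_rw [hG1, hG2] at hle
  exact hle.trans (add_le_add hbp hbm)

open TimeAliasing in
/-- **Platt 2016, Lemma 7.6, even case (Math. Comp. 85, pp. 3019–3020; arXiv:1305.3087v1 Lemma 5.6),
corrected.** Printed: "Given `t ∈ ℝ` and `B > 0`, we define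
`E_e(t) := ζ(9/8) π^{-1/4} |Γ(1/4 + it/2)| e^{(π/4)ηt} ((q/2π)|3/2 + t|)^{5/16}`,
`β_e(t) := π/4 − ½ arctan(1/(2|t|)) − 4/(π²|t² − 1/4|)` […]. Then for `β_e(m/A + B) > (π/4)η` and
`β_e(m/A − B) > −(π/4)η` we have
`|F̃_e(m, χ) − F_e(m/A, χ)| ≤ E_e(m/A + B)/(1 − exp(−B(β_e(m/A + B) − (π/4)η))) + E_e(m/A − B)/(1 − exp(−B(β_e(m/A − B) + (π/4)η)))`.
*Proof.* We apply Lemma 5.7 (i) of [3] with `t = m/A + B` and 5.7 (ii) with `t = m/A − B`, replacing the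
bound for `L_χ(s)` with our Lemma 7.3." Here `F_e(t, χ) = ε_χ q^{it/2} π^{-(1/2+it)/2} Γ((1/2+it)/2) e^{πηt/4} L_χ(1/2+it)`
and `F̃_e(m, χ) := Σ_{k ∈ ℤ} F_e(m/A + kB, χ)` (p. 3017), `A, B > 0`, and `m` ranges over the sample
indices `0 ≤ m < AB = N` of Algorithm 2 (so `m/A + B > 0 > m/A − B`, the sign conditions of Booker's
Lemma 5.7 (i)/(ii); cf. the remark after the lemma, "this only happens for `m` approaching `AB`").
CORRECTION typed here: Lemma 7.3 bounds `|L_χ(1/2+it)|` by `(3/2 + |t|)^{5/16}`, and that is what `E_e`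
carries in this theorem in place of the printed `|3/2 + t|^{5/16}` — identical for the first term
(`t = m/A + B > 0`), larger for the second (`t = m/A − B < 0`, where the printed `E_e` even vanishes at
`t = −3/2`); it is what the printed proof ("replacing the bound for `L_χ(s)` with our Lemma 7.3") yields,
and whether the printed second term also holds is not decided here. Everything else is verbatim
(`½ arctan`, `4/(π²|t² − 1/4|)`, the two denominators); at `|t| = 1/2`, where the printed `β_e` is
undefined, Lean's `4/0 = 0` gives `β_e = π/8` and the bound is proved there too. Not used: `χ` even,
`|η| < 1`, `F_e` real (they belong to the definition of `F_e`, not to this estimate). Booker's printed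
proof bounds the decay rate through (4.3) using monotonicity of `4/(π²|t² − c²|)`, valid for `|t| > c`
only; the remaining range is covered here by `Im ψ ≥ 0` (`TimeAliasing.rate`).
[cite: Platt2016GRH, Lemma 7.6 pp. 3019–3020] [cite: Booker2006, Lemma 5.7] -/
theorem platt2016_lemma76_even {q : ℕ} [NeZero q] (hq : 1 < q) {χ : DirichletCharacter ℂ q}
    (hχ : χ.IsPrimitive) {ε : ℂ} (hε : ‖ε‖ = 1) (η : ℝ)
    (F : ℝ → ℂ) (hF : ∀ t : ℝ, F t = ε * (q : ℂ) ^ (I * t / 2) * (π : ℂ) ^ (-(1 / 2 + I * t) / 2) *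
        Complex.Gamma ((1 / 2 + I * t) / 2) * Complex.exp (π * η * t / 4) *
        χ.LFunction (1 / 2 + I * t))
    (E : ℝ → ℝ) (hE : ∀ t : ℝ, E t = Booker2006Turing.bigZ (9 / 8) * π ^ (-(1 / 4 : ℝ)) *
        ‖Complex.Gamma (1 / 4 + I * t / 2)‖ * Real.exp (π / 4 * η * t) *
        ((q : ℝ) / (2 * π) * (3 / 2 + |t|)) ^ ((5 : ℝ) / 16))
    (β : ℝ → ℝ) (hβ : ∀ t : ℝ, β t = π / 4 - 1 / 2 * Real.arctan (1 / (2 * |t|)) -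
        4 / (π ^ 2 * |t ^ 2 - 1 / 4|))
    {A B : ℝ} (hA : 0 < A) (hB : 0 < B) (m : ℤ) (hm : 0 ≤ m) (hmN : (m : ℝ) < A * B)
    (hβp : π / 4 * η < β (m / A + B)) (hβm : -(π / 4 * η) < β (m / A - B)) :
    Summable (fun k : ℤ => F (m / A + k * B)) ∧
      ‖(∑' k : ℤ, F (m / A + k * B)) - F (m / A)‖ ≤
        E (m / A + B) / (1 - Real.exp (-(B * (β (m / A + B) - π / 4 * η)))) +
          E (m / A - B) / (1 - Real.exp (-(B * (β (m / A - B) + π / 4 * η)))) := by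
  have hF' : ∀ u : ℝ, F u = ε * (q : ℂ) ^ (I * u / 2) * (π : ℂ) ^ (-(((1 / 2 : ℝ) : ℂ) + I * u) / 2) *
      Complex.Gamma ((((1 / 2 : ℝ) : ℂ) + I * u) / 2) * Complex.exp (π * η * u / 4) *
      χ.LFunction (1 / 2 + I * u) := by
    intro u; rw [hF u]; push_cast; ring_nf
  have hE' : ∀ u : ℝ, E u = Booker2006Turing.bigZ (9 / 8) * π ^ (-((1 / 2 : ℝ) / 2)) *
      ‖Complex.Gamma ((((1 / 2 : ℝ) : ℂ) + I * u) / 2)‖ * Real.exp (π * η * u / 4) *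
      ((q : ℝ) / (2 * π) * (3 / 2 + |u|)) ^ ((5 : ℝ) / 16) := by
    intro u; rw [hE u]
    have e1 : (-(1 / 4 : ℝ)) = -((1 / 2 : ℝ) / 2) := by norm_num
    have e2 : (1 / 4 + I * u / 2 : ℂ) = (((1 / 2 : ℝ) : ℂ) + I * u) / 2 := by push_cast; ring
    have e3 : π / 4 * η * u = π * η * u / 4 := by ring
    rw [e1, e2, e3]
  have hβ' : ∀ u : ℝ, β u = π / 4 - (1 / 2 : ℝ) * Real.arctan (1 / (2 * |u|)) -
      4 / (π ^ 2 * |u ^ 2 - (1 / 2) ^ 2|) := by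
    intro u; rw [hβ u]; norm_num
  exact platt2016_lemma76 hq hχ (Or.inl rfl) hε η F hF' E hE' β hβ' hA hB m hm hmN hβp hβm

open TimeAliasing in
/-- **Platt 2016, Lemma 7.6, odd case (Math. Comp. 85, pp. 3019–3020), corrected.** Printed:
"`E_o(t) := ζ(9/8) π^{-3/4} |Γ(3/4 + it/2)| e^{(π/4)ηt} ((q/2π)|3/2 + t|)^{5/16}` and
`β_o(t) := π/4 − (3/2) arctan(1/(2|t|)) − 4/(π²|t² − 9/4|)`. Then for `β_o(m/A + B) > (π/4)η` and
`β_o(m/A − B) > −(π/4)η` we have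
`|F̃_o(m, χ) − F_o(m/A, χ)| ≤ E_o(m/A + B)/(1 − exp(−B(β_o(m/A+B) − (π/4)η))) + E_o(m/A − B)/(1 − exp(−B(β_o(m/A−B) + (π/4)η)))`."
`F_o(t, χ) = ε_χ q^{it/2} π^{-(3/2+it)/2} Γ((3/2+it)/2) e^{πηt/4} L_χ(1/2+it)`, `F̃_o(m, χ) := Σ_{k ∈ ℤ} F_o(m/A + kB, χ)`;
conventions, the range `0 ≤ m < AB` and the CORRECTION `|3/2 + t| ↦ 3/2 + |t|` exactly as in
`platt2016_lemma76_even`. (Platt's `(3/2) arctan(1/(2|t|))` is weaker than Booker's `½ arctan(3/(2|t|))`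
— `arctan 3u ≤ 3 arctan u` — and is typed verbatim; at `|t| = 3/2` Lean's `4/0 = 0` value
`β_o = π/4 − (3/2) arctan(1/3)` is covered.) [cite: Platt2016GRH, Lemma 7.6 pp. 3019–3020]
[cite: Booker2006, Lemma 5.7] -/
theorem platt2016_lemma76_odd {q : ℕ} [NeZero q] (hq : 1 < q) {χ : DirichletCharacter ℂ q}
    (hχ : χ.IsPrimitive) {ε : ℂ} (hε : ‖ε‖ = 1) (η : ℝ)
    (F : ℝ → ℂ) (hF : ∀ t : ℝ, F t = ε * (q : ℂ) ^ (I * t / 2) * (π : ℂ) ^ (-(3 / 2 + I * t) / 2) *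
        Complex.Gamma ((3 / 2 + I * t) / 2) * Complex.exp (π * η * t / 4) *
        χ.LFunction (1 / 2 + I * t))
    (E : ℝ → ℝ) (hE : ∀ t : ℝ, E t = Booker2006Turing.bigZ (9 / 8) * π ^ (-(3 / 4 : ℝ)) *
        ‖Complex.Gamma (3 / 4 + I * t / 2)‖ * Real.exp (π / 4 * η * t) *
        ((q : ℝ) / (2 * π) * (3 / 2 + |t|)) ^ ((5 : ℝ) / 16))
    (β : ℝ → ℝ) (hβ : ∀ t : ℝ, β t = π / 4 - 3 / 2 * Real.arctan (1 / (2 * |t|)) -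
        4 / (π ^ 2 * |t ^ 2 - 9 / 4|))
    {A B : ℝ} (hA : 0 < A) (hB : 0 < B) (m : ℤ) (hm : 0 ≤ m) (hmN : (m : ℝ) < A * B)
    (hβp : π / 4 * η < β (m / A + B)) (hβm : -(π / 4 * η) < β (m / A - B)) :
    Summable (fun k : ℤ => F (m / A + k * B)) ∧
      ‖(∑' k : ℤ, F (m / A + k * B)) - F (m / A)‖ ≤
        E (m / A + B) / (1 - Real.exp (-(B * (β (m / A + B) - π / 4 * η)))) +
          E (m / A - B) / (1 - Real.exp (-(B * (β (m / A - B) + π / 4 * η)))) := by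
  have hF' : ∀ u : ℝ, F u = ε * (q : ℂ) ^ (I * u / 2) * (π : ℂ) ^ (-(((3 / 2 : ℝ) : ℂ) + I * u) / 2) *
      Complex.Gamma ((((3 / 2 : ℝ) : ℂ) + I * u) / 2) * Complex.exp (π * η * u / 4) *
      χ.LFunction (1 / 2 + I * u) := by
    intro u; rw [hF u]; push_cast; ring_nf
  have hE' : ∀ u : ℝ, E u = Booker2006Turing.bigZ (9 / 8) * π ^ (-((3 / 2 : ℝ) / 2)) *
      ‖Complex.Gamma ((((3 / 2 : ℝ) : ℂ) + I * u) / 2)‖ * Real.exp (π * η * u / 4) *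
      ((q : ℝ) / (2 * π) * (3 / 2 + |u|)) ^ ((5 : ℝ) / 16) := by
    intro u; rw [hE u]
    have e1 : (-(3 / 4 : ℝ)) = -((3 / 2 : ℝ) / 2) := by norm_num
    have e2 : (3 / 4 + I * u / 2 : ℂ) = (((3 / 2 : ℝ) : ℂ) + I * u) / 2 := by push_cast; ring
    have e3 : π / 4 * η * u = π * η * u / 4 := by ring
    rw [e1, e2, e3]
  have hβ' : ∀ u : ℝ, β u = π / 4 - (3 / 2 : ℝ) * Real.arctan (1 / (2 * |u|)) -
      4 / (π ^ 2 * |u ^ 2 - (3 / 2) ^ 2|) := by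
    intro u; rw [hβ u]; norm_num
  exact platt2016_lemma76 hq hχ (Or.inr rfl) hε η F hF' E hE' β hβ' hA hB m hm hmN hβp hβm

end Literature.NumberTheory.LFunctions

end
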